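import Mathlib
import Summits.QuantumFields.QCD.Theorems.WilsonQuarkChessboardBackgroundSchwarzPerturb
import Summits.QuantumFields.QCD.Theorems.WilsonQuarkChessboardBackgroundSchwarzAssemble

/-!
# The background Schwarz inequality for the reindexed twisted Wilson–Dirac matrices (helper for `BackgroundSchwarz`)

Combines the block identification (`assemble_eq`) for the field `U` and its two reflection doubles
with the positivity of the hyperplane blocks (`planeBlock_posDef`, `m > -1`) and the abstract block
Schwarz inequality (`schwarz_assemble`): the determinants of the reindexed twisted rotated
Wilson–Dirac matrices of `U⁺⁺`, `U⁻⁻` are real `≥ 0` and dominate `|det|²` of that of `U`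
(`schwarz_reindexed`).
-/

noncomputable section

namespace Summit.QuantumFields.QCD.Theorems.BackgroundSchwarz

open Matrix Complex Finset
open Literature.MathematicalPhysics Literature.MathematicalPhysics.QuantumLattice
  Literature.MathematicalPhysics.QuantumFieldTheory Literature.Probability.LatticeModels

variable {L N : ℕ} [NeZero L] {K : ℕ}

local notation "𝕌" => Matrix.unitaryGroup (Fin N) ℂ
local notation "ρ₀" => Literature.MathematicalPhysics.QuantumLattice.unitaryFundamentalRep (Fin N) ℂ
/-- Interior positive time `k + 1`. -/
local notation "τP[" k "]" => ((((k : ℕ) + 1 : ℕ) : ZMod L))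
/-- Hyperplane times `0` and `K + 2 = L/2`. -/
local notation "τB[" c "]" => ((![(0 : ZMod L), ((K + 2 : ℕ) : ZMod L)] : Fin 2 → ZMod L) c)
/-- The swapped sign block. -/
local notation "σ2[" c "]" => ((![(1 : Fin 2), 0] : Fin 2 → Fin 2) c)
set_option quotPrecheck false in
/-- Positive interior index. -/
local notation "EP[" i "]" =>
  (((Fin.cons τP[i.2.1] i.2.2.1 : TorusSite 4 L)), i.2.2.2.1, spin4[i.1, i.2.2.2.2])
set_option quotPrecheck false in
/-- Reflected interior index. -/
local notation "EN[" i "]" =>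
  (((Fin.cons (-τP[i.2.1]) i.2.2.1 : TorusSite 4 L)), i.2.2.2.1, spin4[i.1, i.2.2.2.2])
set_option quotPrecheck false in
/-- Hyperplane index, first kind (`(+,0)`, `(-,L/2)`). -/
local notation "EB1[" i "]" =>
  (((Fin.cons τB[i.1] i.2.1 : TorusSite 4 L)), i.2.2.1, spin4[i.1, i.2.2.2])
set_option quotPrecheck false in
/-- Hyperplane index, second kind (`(-,0)`, `(+,L/2)`). -/
local notation "EB2[" i "]" =>
  (((Fin.cons τB[i.1] i.2.1 : TorusSite 4 L)), i.2.2.1, spin4[σ2[i.1], i.2.2.2])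
set_option quotPrecheck false in
/-- The `γ₀`-sign of a sign block. -/
local notation "sgn[" σ "]" => (if σ = (0 : Fin 2) then (1 : ℂ) else -1)


set_option quotPrecheck false in
/-- The reindexing map (as in `…Index`). -/
local notation "Emb" => (Sum.elim
    (Sum.elim
      (fun i : Fin 2 × Fin (K + 1) × ((Fin 3 → ZMod L) × Fin N × Fin 2) => EP[i])
      (fun i : Fin 2 × Fin (K + 1) × ((Fin 3 → ZMod L) × Fin N × Fin 2) => EN[i]))
    (Sum.elim
      (fun i : Fin 2 × ((Fin 3 → ZMod L) × Fin N × Fin 2) => EB1[i])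
      (fun i : Fin 2 × ((Fin 3 → ZMod L) × Fin N × Fin 2) => EB2[i])))

set_option synthInstance.maxSize 1024 in
-- the `DecidableEq` instance of the reindexing type `(ι ⊕ ι) ⊕ (β ⊕ β)` exceeds the default size
/-- **The background Schwarz inequality for the reindexed matrices.**  For the doubles `U⁺⁺, U⁻⁻`
of a `U(N)` field `U` (given pointwise through `posE`/`Θcfg`) and `m > -1`, `L = 2K + 4`: the
determinants of the reindexed twisted rotated Wilson–Dirac matrices of `U⁺⁺` and `U⁻⁻` are real and
non-negative, and `‖det(U)‖² ≤ det(U⁺⁺) · det(U⁻⁻)`. -/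
theorem schwarz_reindexed (hK : L = 2 * K + 4) (U Upp Umm : GaugeConfig 4 L 𝕌) (m : ℝ) (hm : -1 < m)
    (hUpp_pos : ∀ e : Edge 4 L, posE[L, e] → Upp e = U e)
    (hUpp_neg : ∀ e : Edge 4 L, ¬posE[L, e] → Upp e = Θcfg[U] e)
    (hUmm_pos : ∀ e : Edge 4 L, posE[L, e] → Umm e = Θcfg[U] e)
    (hUmm_neg : ∀ e : Edge 4 L, ¬posE[L, e] → Umm e = U e) :
    0 ≤ (((rotD[ρ₀, apTw[L, Upp], m]).submatrix Emb Emb).det).re ∧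
    (((rotD[ρ₀, apTw[L, Upp], m]).submatrix Emb Emb).det).im = 0 ∧
    0 ≤ (((rotD[ρ₀, apTw[L, Umm], m]).submatrix Emb Emb).det).re ∧
    (((rotD[ρ₀, apTw[L, Umm], m]).submatrix Emb Emb).det).im = 0 ∧
    ‖((rotD[ρ₀, apTw[L, U], m]).submatrix Emb Emb).det‖ ^ 2 ≤
      (((rotD[ρ₀, apTw[L, Upp], m]).submatrix Emb Emb).det).re *
        (((rotD[ρ₀, apTw[L, Umm], m]).submatrix Emb Emb).det).re := by
  haveI := fact_one_lt hK
  have hL2 := two_mul_half hK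
  -- the hyperplane data
  have hτ : ∀ i j : Fin 2, i ≠ j → τB[i] ≠ τB[j] := fun i j hij h => hij (τB_inj hK h)
  have hτ1 : ∀ i j : Fin 2, τB[j] ≠ τB[i] + 1 := fun i j => τB_ne_τB_add_one hK i j
  -- reflection symmetry of the doubles and agreement in the hyperplanes
  have hΘpp := eq_Θcfg_pp hL2 U Upp hUpp_pos hUpp_neg
  have hΘmm := mm_eq_Θcfg_mm hL2 U Umm hUmm_pos hUmm_neg
  have hplane_pp : ∀ (c : Fin 2) (xs : Fin 3 → ZMod L) (k : Fin 3),
      apTw[L, Upp] ((Fin.cons τB[c] xs : TorusSite 4 L), k.succ) = apTw[L, U] ((Fin.cons τB[c] xs : TorusSite 4 L), k.succ) := by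
    intro c xs k
    simp only [Fin.cons_succ, pp_plane U Upp hUpp_pos (val_τB_le hK c) xs k]
  have hplane_mm : ∀ (c : Fin 2) (xs : Fin 3 → ZMod L) (k : Fin 3),
      apTw[L, Umm] ((Fin.cons τB[c] xs : TorusSite 4 L), k.succ) = apTw[L, U] ((Fin.cons τB[c] xs : TorusSite 4 L), k.succ) := by
    intro c xs k
    simp only [Fin.cons_succ, mm_plane U Umm hUmm_pos (val_τB_le hK c) (neg_τB hK c) xs k]
  -- the three block identifications
  have hPQ := assemble_eq hK m U U Umm U (fun _ _ => rfl) hUmm_pos rfl rfl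
  have hPP := assemble_eq hK m Upp U U U hUpp_pos hΘpp
    (planeBlock_congr (apTw[L, Upp]) (apTw[L, U]) m (![(0 : ZMod L), ((K + 2 : ℕ) : ZMod L)]) (fun c => c)
      hτ hτ1 hplane_pp)
    (planeBlock_congr (apTw[L, Upp]) (apTw[L, U]) m (![(0 : ZMod L), ((K + 2 : ℕ) : ZMod L)]) (fun c => σ2[c])
      hτ hτ1 hplane_pp)
  have hQQ := assemble_eq hK m Umm Umm Umm U (fun _ _ => rfl) hΘmm
    (planeBlock_congr (apTw[L, Umm]) (apTw[L, U]) m (![(0 : ZMod L), ((K + 2 : ℕ) : ZMod L)]) (fun c => c)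
      hτ hτ1 hplane_mm)
    (planeBlock_congr (apTw[L, Umm]) (apTw[L, U]) m (![(0 : ZMod L), ((K + 2 : ℕ) : ZMod L)]) (fun c => σ2[c])
      hτ hτ1 hplane_mm)
  -- positivity of the hyperplane blocks and the sign matrix
  have hB₁ := planeBlock_posDef (apTw[L, U]) m (![(0 : ZMod L), ((K + 2 : ℕ) : ZMod L)]) (fun c => c) hτ hτ1 hm
  have hB₂ := planeBlock_posDef (apTw[L, U]) m (![(0 : ZMod L), ((K + 2 : ℕ) : ZMod L)]) (fun c => σ2[c]) hτ hτ1 hm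
  have hSg : Matrix.diagonal (fun i : Fin 2 × Fin (K + 1) × ((Fin 3 → ZMod L) × Fin N × Fin 2) => sgn[i.1]) *
      Matrix.diagonal (fun i : Fin 2 × Fin (K + 1) × ((Fin 3 → ZMod L) × Fin N × Fin 2) => sgn[i.1]) = 1 := by
    rw [diagonal_mul_diagonal, ← diagonal_one]
    congr 1
    funext i
    split_ifs <;> norm_num
  -- the abstract Schwarz inequality for the block assembly (all blocks explicit)
  obtain ⟨k1, k2, k3, k4, k5⟩ := schwarz_assemble
    (Matrix.diagonal (fun i : Fin 2 × Fin (K + 1) × ((Fin 3 → ZMod L) × Fin N × Fin 2) => sgn[i.1]))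
    (Matrix.of fun i j : Fin 2 × ((Fin 3 → ZMod L) × Fin N × Fin 2) => rotD[ρ₀, apTw[L, U], m] EB1[i] EB1[j])
    (Matrix.of fun i j : Fin 2 × ((Fin 3 → ZMod L) × Fin N × Fin 2) => rotD[ρ₀, apTw[L, U], m] EB2[i] EB2[j])
    (Matrix.of fun i j : Fin 2 × Fin (K + 1) × ((Fin 3 → ZMod L) × Fin N × Fin 2) =>
      rotD[ρ₀, apTw[L, U], m] EP[i] EP[j])
    (Matrix.of fun (i : Fin 2 × Fin (K + 1) × ((Fin 3 → ZMod L) × Fin N × Fin 2))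
      (j : Fin 2 × ((Fin 3 → ZMod L) × Fin N × Fin 2)) => rotD[ρ₀, apTw[L, U], m] EP[i] EB1[j])
    (Matrix.of fun (i : Fin 2 × ((Fin 3 → ZMod L) × Fin N × Fin 2))
      (j : Fin 2 × Fin (K + 1) × ((Fin 3 → ZMod L) × Fin N × Fin 2)) => rotD[ρ₀, apTw[L, U], m] EB2[i] EP[j])
    (Matrix.of fun i j : Fin 2 × ((Fin 3 → ZMod L) × Fin N × Fin 2) => rotD[ρ₀, apTw[L, U], m] EB2[i] EB1[j])
    (Matrix.of fun i j : Fin 2 × Fin (K + 1) × ((Fin 3 → ZMod L) × Fin N × Fin 2) =>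
      rotD[ρ₀, apTw[L, Umm], m] EP[i] EP[j])
    (Matrix.of fun (i : Fin 2 × Fin (K + 1) × ((Fin 3 → ZMod L) × Fin N × Fin 2))
      (j : Fin 2 × ((Fin 3 → ZMod L) × Fin N × Fin 2)) => rotD[ρ₀, apTw[L, Umm], m] EP[i] EB1[j])
    (Matrix.of fun (i : Fin 2 × ((Fin 3 → ZMod L) × Fin N × Fin 2))
      (j : Fin 2 × Fin (K + 1) × ((Fin 3 → ZMod L) × Fin N × Fin 2)) => rotD[ρ₀, apTw[L, Umm], m] EB2[i] EP[j])
    (Matrix.of fun i j : Fin 2 × ((Fin 3 → ZMod L) × Fin N × Fin 2) => rotD[ρ₀, apTw[L, Umm], m] EB2[i] EB1[j])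
    hSg hB₁ hB₂
  have dPQ := congrArg Matrix.det hPQ
  have dPP := congrArg Matrix.det hPP
  have dQQ := congrArg Matrix.det hQQ
  refine ⟨?_, ?_, ?_, ?_, ?_⟩
  · rw [dPP]; exact k1
  · rw [dPP]; exact k2
  · rw [dQQ]; exact k3
  · rw [dQQ]; exact k4
  · rw [dPQ, dPP, dQQ]; exact k5

end Summit.QuantumFields.QCD.Theorems.BackgroundSchwarz
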